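import Literature.MathematicalPhysics.QuantumLattice.ClusteringFromCommutatorBounds

/-!
# One-sided-gap (sector-relative) Hastings–Koma filtering for anticommuting observables

Support file for item `stmt-HubbardSuperconductivity-2197` (`ParityGapClustering`) of route
`HubbardSuperconductivity/ParityGapRigidity`. Generic matrix form of the "filter" step of
Hastings–Koma, CMP **265** (2006) §3 (Thm. 2 there, the fermionic case), in the ONE-SIDED form the
item needs: for a Hermitian `H`, a unit vector `ψ` with `Hψ = E₀ψ`, and two observables `A`, `B` with
`{A, B} = 0`, suppose the vector `Bψ` is spectrally supported (w.r.t. `H`) in `[E₀ - μ_s + γ, ∞)` and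
`Aψ` in `[E₀ + μ_s + γ, ∞)` for some shift `μ_s ∈ ℝ` (in the application `μ_s` is the chemical
potential `(E(N+1) - E(N-1))/2`, `Bψ = c_y ψ` lies in the `(N-1)`-particle space and `Aψ = c†_x ψ`
in the `(N+1)`-particle space; no gap INSIDE the sector of `ψ` and no global gap is assumed). Then
the Lieb–Robinson-type bound `‖{A, τ_t(B)}‖ ≤ C e^{-μ(D - v|t|)}` and the Lipschitz input
`‖[H, B]‖ ≤ Q` give `|⟨ψ, A B ψ⟩| ≤ (2 + 2Q + 4C/(vμ) + 8v/γ) e^{-D/ξ}`, `ξ = max(8/μ, 4v/γ)`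
(`norm_expect_mul_le_of_oneSidedGaps`). Proof: the tree's `abstract_clustering_bound` (Gaussian
filter, finite spectral resolution) applied to `h(t) = e^{itμ_s} ⟨ψ, {A, τ_t(B)} ψ⟩` on the index
set `Option (m ⊕ m)` (a dummy zero-weight ground mode `none`; the `B`-modes with frequencies
`λᵢ - E₀ + μ_s`, the `A`-modes with `λᵢ - E₀ - μ_s`), and the tree's `clustering_arith`.
Theorems only; no definitions.

References: M. B. Hastings, T. Koma, CMP 265 (2006) 781, §3 and Thm. 2; B. Nachtergaele, R. Sims,
CMP 265 (2006) 119, §3.2.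
-/

noncomputable section

-- the mandated namespace `Summit.<Summit>.<Problem>.Theorems` repeats `HubbardSuperconductivity`
-- (single-problem summit, D-0017), which the `dupNamespace` linter flags on every declaration
set_option linter.dupNamespace false

open Matrix Complex Finset Real
open scoped Matrix.Norms.L2Operator ComplexOrder InnerProductSpace

namespace Summit.HubbardSuperconductivity.HubbardSuperconductivity.Theorems

open Literature.MathematicalPhysics.QuantumLattice

variable {m : Type*} [Fintype m] [DecidableEq m]

/-- **Spectral representation of `⟨ψ, A τ_t(B) ψ⟩`** in a vector `ψ` with `Hψ = E₀ψ`: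
`⟨ψ, A τ_t(B) ψ⟩ = Σᵢ ⟨ψ,Avᵢ⟩⟨vᵢ,Bψ⟩ e^{it(λᵢ-E₀)}` (the first half of the tree's
`commutator_expect_eq_sum`). Hastings–Koma, CMP 265 (2006) §3. [folklore] -/
theorem expect_mul_heisenbergEvolution_eq_sum {H : Matrix m m ℂ} (hH : H.IsHermitian)
    (A B : Matrix m m ℂ) {ψ : m → ℂ} {E₀ : ℝ} (hψ : H *ᵥ ψ = (E₀ : ℂ) • ψ) (t : ℝ) :
    star ψ ⬝ᵥ ((A * heisenbergEvolution H t B) *ᵥ ψ) =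
      ∑ i, (star ψ ⬝ᵥ (A *ᵥ ⇑(hH.eigenvectorBasis i))) *
        (star (⇑(hH.eigenvectorBasis i)) ⬝ᵥ (B *ᵥ ψ)) *
        cexp (((t * (hH.eigenvalues i - E₀) : ℝ) : ℂ) * I) := by
  set U := NormedSpace.exp ((I * (t : ℂ)) • H) with hU
  set V := NormedSpace.exp ((-(I * (t : ℂ))) • H) with hV
  have hVψ : V *ᵥ ψ = cexp (-(I * t) * E₀) • ψ := exp_smul_mulVec_of_mulVec_eq H hψ _
  have h1 : star ψ ⬝ᵥ (A *ᵥ (U *ᵥ (B *ᵥ (V *ᵥ ψ)))) =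
      ∑ i, (star ψ ⬝ᵥ (A *ᵥ ⇑(hH.eigenvectorBasis i))) *
        (star (⇑(hH.eigenvectorBasis i)) ⬝ᵥ (B *ᵥ ψ)) *
        cexp (((t * (hH.eigenvalues i - E₀) : ℝ) : ℂ) * I) := by
    rw [hVψ, mulVec_smul, mulVec_smul, mulVec_smul, dotProduct_smul, smul_eq_mul, hU,
      dotProduct_mulVec_exp_mulVec hH A ψ (B *ᵥ ψ) (I * t), Finset.mul_sum]
    refine Finset.sum_congr rfl fun i _ => ?_
    rw [show cexp (-(I * ↑t) * ↑E₀) * (cexp (I * ↑t * ↑(hH.eigenvalues i)) *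
        (star ⇑(hH.eigenvectorBasis i) ⬝ᵥ B *ᵥ ψ) * (star ψ ⬝ᵥ A *ᵥ ⇑(hH.eigenvectorBasis i))) =
        (star ψ ⬝ᵥ A *ᵥ ⇑(hH.eigenvectorBasis i)) * (star ⇑(hH.eigenvectorBasis i) ⬝ᵥ B *ᵥ ψ) *
        (cexp (-(I * ↑t) * ↑E₀) * cexp (I * ↑t * ↑(hH.eigenvalues i))) by ring,
      ← Complex.exp_add]
    congr 2
    push_cast
    ring
  rw [heisenbergEvolution, ← hU, ← hV]
  simp only [← mulVec_mulVec]
  exact h1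

/-- **Spectral representation of `⟨ψ, τ_t(B) A ψ⟩`** in a vector `ψ` with `Hψ = E₀ψ`:
`⟨ψ, τ_t(B) A ψ⟩ = Σᵢ ⟨ψ,Bvᵢ⟩⟨vᵢ,Aψ⟩ e^{-it(λᵢ-E₀)}` (the second half of the tree's
`commutator_expect_eq_sum`). Hastings–Koma, CMP 265 (2006) §3. [folklore] -/
theorem expect_heisenbergEvolution_mul_eq_sum {H : Matrix m m ℂ} (hH : H.IsHermitian)
    (A B : Matrix m m ℂ) {ψ : m → ℂ} {E₀ : ℝ} (hψ : H *ᵥ ψ = (E₀ : ℂ) • ψ) (t : ℝ) :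
    star ψ ⬝ᵥ ((heisenbergEvolution H t B * A) *ᵥ ψ) =
      ∑ i, (star ψ ⬝ᵥ (B *ᵥ ⇑(hH.eigenvectorBasis i))) *
        (star (⇑(hH.eigenvectorBasis i)) ⬝ᵥ (A *ᵥ ψ)) *
        cexp (-((t * (hH.eigenvalues i - E₀) : ℝ) : ℂ) * I) := by
  have hc := commutator_expect_eq_sum hH A B hψ t
  have hg := expect_mul_heisenbergEvolution_eq_sum hH A B hψ t
  have hsplit : star ψ ⬝ᵥ ((heisenbergEvolution H t B * A) *ᵥ ψ) =
      star ψ ⬝ᵥ ((A * heisenbergEvolution H t B) *ᵥ ψ) -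
        star ψ ⬝ᵥ ((A * heisenbergEvolution H t B - heisenbergEvolution H t B * A) *ᵥ ψ) := by
    rw [sub_mulVec, dotProduct_sub]
    ring
  rw [hsplit, hc, hg, ← Finset.sum_sub_distrib]
  refine Finset.sum_congr rfl fun i _ => ?_
  ring

/-- **One-sided-gap exponential clustering for anticommuting observables (sector-relative
Hastings–Koma, generic matrix form).** Let `H` be Hermitian, `ψ` a unit vector with `Hψ = E₀ψ`,
`‖A‖, ‖B‖ ≤ 1` with `AB + BA = 0`. Suppose that for some shift `μ_s` and `γ > 0` every eigenvector
`vᵢ` of `H` meeting `Bψ` has `λᵢ - E₀ + μ_s ≥ γ` and every eigenvector meeting `Aψ` has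
`λᵢ - E₀ - μ_s ≥ γ` (one-sided gaps on the two "charge sectors" reached by `B` and `A`; nothing is
assumed about the rest of the spectrum), that `‖[H, B]‖ ≤ Q`, and the Lieb–Robinson-type input
`‖{A, τ_t(B)}‖ ≤ C e^{-μ(D - v|t|)}` for all real `t`, at "distance" `D ≥ max(2v, 1)`. Then
`|⟨ψ, A B ψ⟩| ≤ (2 + 2Q + 4C/(vμ) + 8v/γ) e^{-D/ξ}`, `ξ = max(8/μ, 4v/γ)`.
Proof: `abstract_clustering_bound` for `h(t) = e^{itμ_s}⟨ψ, {A, τ_t(B)} ψ⟩` on `Option (m ⊕ m)`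
with parameters `T = D/2v`, `t₁ = e^{-μD/4}`, `α = γv/D`, then `clustering_arith`.
Hastings–Koma, CMP 265 (2006) 781, §3 (Thm. 2, fermionic observables), here with the gap
hypothesis restricted to the spectral supports of `Bψ`, `Aψ`. [folklore] -/
theorem norm_expect_mul_le_of_oneSidedGaps {H A B : Matrix m m ℂ} (hH : H.IsHermitian)
    {ψ : m → ℂ} {E₀ μs γ C μ v D Q : ℝ}
    (hψ : H *ᵥ ψ = (E₀ : ℂ) • ψ) (hψ1 : star ψ ⬝ᵥ ψ = 1)
    (hγ : 0 < γ) (hC : 0 ≤ C) (hμ : 0 < μ) (hv : 0 < v) (hQ : 0 ≤ Q)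
    (hA1 : ‖A‖ ≤ 1) (hB1 : ‖B‖ ≤ 1) (hAB : A * B + B * A = 0)
    (hgapB : ∀ i, star (⇑(hH.eigenvectorBasis i)) ⬝ᵥ (B *ᵥ ψ) ≠ 0 →
      γ ≤ hH.eigenvalues i - E₀ + μs)
    (hgapA : ∀ i, star (⇑(hH.eigenvectorBasis i)) ⬝ᵥ (A *ᵥ ψ) ≠ 0 →
      γ ≤ hH.eigenvalues i - E₀ - μs)
    (hcomm : ‖H * B - B * H‖ ≤ Q)
    (hLR : ∀ t : ℝ, ‖A * heisenbergEvolution H t B + heisenbergEvolution H t B * A‖ ≤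
      C * Real.exp (-μ * (D - v * |t|)))
    (hD : max (2 * v) 1 ≤ D) :
    ‖star ψ ⬝ᵥ ((A * B) *ᵥ ψ)‖ ≤
      (2 + 2 * Q + 4 * C / (v * μ) + 8 * v / γ) * Real.exp (-D / max (8 / μ) (4 * v / γ)) := by
  have hD1 : 1 ≤ D := le_trans (le_max_right _ _) hD
  have hD2v : 2 * v ≤ D := le_trans (le_max_left _ _) hD
  have hD0 : 0 < D := lt_of_lt_of_le one_pos hD1
  -- spectral weights
  obtain ⟨α, hα⟩ : ∃ α : m → ℂ, ∀ i, α i =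
      (star ψ ⬝ᵥ (A *ᵥ ⇑(hH.eigenvectorBasis i))) *
        (star (⇑(hH.eigenvectorBasis i)) ⬝ᵥ (B *ᵥ ψ)) := ⟨_, fun i => rfl⟩
  obtain ⟨β, hβ⟩ : ∃ β : m → ℂ, ∀ i, β i =
      (star ψ ⬝ᵥ (B *ᵥ ⇑(hH.eigenvectorBasis i))) *
        (star (⇑(hH.eigenvectorBasis i)) ⬝ᵥ (A *ᵥ ψ)) := ⟨_, fun i => rfl⟩
  -- modes on `Option (m ⊕ m)`: ground mode `none`, `B`-modes `inl`, `A`-modes `inr`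
  obtain ⟨Δ, hΔn, hΔl, hΔr⟩ : ∃ Δ : Option (m ⊕ m) → ℝ, Δ none = 0 ∧
      (∀ i, Δ (some (Sum.inl i)) = max γ (hH.eigenvalues i - E₀ + μs)) ∧
      (∀ i, Δ (some (Sum.inr i)) = max γ (hH.eigenvalues i - E₀ - μs)) :=
    ⟨fun o => o.elim 0 (Sum.elim (fun i => max γ (hH.eigenvalues i - E₀ + μs))
      (fun i => max γ (hH.eigenvalues i - E₀ - μs))), rfl, fun _ => rfl, fun _ => rfl⟩
  obtain ⟨a, han, hal, har⟩ : ∃ a : Option (m ⊕ m) → ℂ, a none = 0 ∧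
      (∀ i, a (some (Sum.inl i)) = α i) ∧ (∀ i, a (some (Sum.inr i)) = 0) :=
    ⟨fun o => o.elim 0 (Sum.elim α 0), rfl, fun _ => rfl, fun _ => rfl⟩
  obtain ⟨b, hbn, hbl, hbr⟩ : ∃ b : Option (m ⊕ m) → ℂ, b none = 0 ∧
      (∀ i, b (some (Sum.inl i)) = 0) ∧ (∀ i, b (some (Sum.inr i)) = -β i) :=
    ⟨fun o => o.elim 0 (Sum.elim 0 fun i => -β i), rfl, fun _ => rfl, fun _ => rfl⟩
  -- the anticommutator function and its filtered version
  obtain ⟨K, hK⟩ : ∃ K : ℝ → ℂ, ∀ t, K t =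
      star ψ ⬝ᵥ ((A * heisenbergEvolution H t B + heisenbergEvolution H t B * A) *ᵥ ψ) :=
    ⟨_, fun t => rfl⟩
  obtain ⟨hfun, hhfun⟩ : ∃ hfun : ℝ → ℂ, ∀ t, hfun t = cexp (((t * μs : ℝ) : ℂ) * I) * K t :=
    ⟨_, fun t => rfl⟩
  -- dead modes: a weight is zero unless its frequency is the true one
  have hdeadl : ∀ i (t : ℝ), cexp (((t * μs : ℝ) : ℂ) * I) *
      (α i * cexp (((t * (hH.eigenvalues i - E₀) : ℝ) : ℂ) * I)) =
      a (some (Sum.inl i)) * cexp (((t * Δ (some (Sum.inl i)) : ℝ) : ℂ) * I) := by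
    intro i t
    rw [hal, hΔl]
    by_cases h0 : star (⇑(hH.eigenvectorBasis i)) ⬝ᵥ (B *ᵥ ψ) = 0
    · rw [hα, h0, mul_zero, zero_mul, zero_mul, mul_zero]
    · rw [max_eq_right (hgapB i h0), mul_left_comm, ← Complex.exp_add]
      congr 2
      push_cast
      ring
  have hdeadr : ∀ i (t : ℝ), cexp (((t * μs : ℝ) : ℂ) * I) *
      (β i * cexp (-((t * (hH.eigenvalues i - E₀) : ℝ) : ℂ) * I)) =
      -(b (some (Sum.inr i)) * cexp (-((t * Δ (some (Sum.inr i)) : ℝ) : ℂ) * I)) := by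
    intro i t
    rw [hbr, hΔr]
    simp only [neg_mul, neg_neg]
    by_cases h0 : star (⇑(hH.eigenvectorBasis i)) ⬝ᵥ (A *ᵥ ψ) = 0
    · rw [hβ, h0, mul_zero, zero_mul, zero_mul, mul_zero]
    · rw [max_eq_right (hgapA i h0), mul_left_comm, ← Complex.exp_add]
      congr 2
      push_cast
      ring
  -- hypotheses of the abstract bound
  have hΔγ : ∀ o, o ≠ none → γ ≤ Δ o := by
    rintro (_ | ⟨i | i⟩) ho
    · exact absurd rfl ho
    · rw [hΔl]; exact le_max_left _ _
    · rw [hΔr]; exact le_max_left _ _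
  have hab : a none = b none := by rw [han, hbn]
  have hKa : ∑ o, ‖a o‖ ≤ 1 * 1 := by
    rw [Fintype.sum_option, Fintype.sum_sum_type, han, norm_zero, zero_add]
    simp only [hal, har, norm_zero, Finset.sum_const_zero, add_zero]
    simp only [hα]
    refine (sum_norm_weights_le hH A B hψ1).trans ?_
    exact mul_le_mul hA1 hB1 (norm_nonneg _) zero_le_one
  have hKb : ∑ o, ‖b o‖ ≤ 1 * 1 := by
    rw [Fintype.sum_option, Fintype.sum_sum_type, hbn, norm_zero, zero_add]
    simp only [hbl, hbr, norm_zero, norm_neg, Finset.sum_const_zero, zero_add]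
    simp only [hβ]
    refine (sum_norm_weights_le hH B A hψ1).trans ?_
    exact mul_le_mul hB1 hA1 (norm_nonneg _) zero_le_one
  have hh : ∀ t : ℝ, hfun t =
      ∑ o, (a o * cexp ((t * Δ o : ℝ) * I) - b o * cexp (-(t * Δ o : ℝ) * I)) := by
    intro t
    rw [Fintype.sum_option, Fintype.sum_sum_type, han, hbn, zero_mul, zero_mul, sub_zero,
      zero_add]
    have e1 : ∑ i, (a (some (Sum.inl i)) * cexp ((t * Δ (some (Sum.inl i)) : ℝ) * I) -
        b (some (Sum.inl i)) * cexp (-(t * Δ (some (Sum.inl i)) : ℝ) * I)) =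
        ∑ i, cexp (((t * μs : ℝ) : ℂ) * I) *
          (α i * cexp (((t * (hH.eigenvalues i - E₀) : ℝ) : ℂ) * I)) := by
      refine Finset.sum_congr rfl fun i _ => ?_
      rw [hdeadl, hbl, zero_mul, sub_zero]
    have e2 : ∑ i, (a (some (Sum.inr i)) * cexp ((t * Δ (some (Sum.inr i)) : ℝ) * I) -
        b (some (Sum.inr i)) * cexp (-(t * Δ (some (Sum.inr i)) : ℝ) * I)) =
        ∑ i, cexp (((t * μs : ℝ) : ℂ) * I) *
          (β i * cexp (-((t * (hH.eigenvalues i - E₀) : ℝ) : ℂ) * I)) := by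
      refine Finset.sum_congr rfl fun i _ => ?_
      rw [hdeadr, har, zero_mul, zero_sub]
    rw [e1, e2, ← Finset.mul_sum, ← Finset.mul_sum, ← mul_add, hhfun, hK, add_mulVec,
      dotProduct_add, expect_mul_heisenbergEvolution_eq_sum hH A B hψ t,
      expect_heisenbergEvolution_mul_eq_sum hH A B hψ t]
    simp only [hα, hβ]
  -- the three bounds on `h`
  have hnormh : ∀ t, ‖hfun t‖ = ‖K t‖ := by
    intro t
    rw [hhfun, norm_mul, Complex.norm_exp_ofReal_mul_I, one_mul]
  have hKle : ∀ t, ‖K t‖ ≤ ‖A * heisenbergEvolution H t B + heisenbergEvolution H t B * A‖ := by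
    intro t
    rw [hK]
    exact norm_vectorState_le hψ1 _
  have hanti : ∀ t, A * heisenbergEvolution H t B + heisenbergEvolution H t B * A =
      A * (heisenbergEvolution H t B - B) + (heisenbergEvolution H t B - B) * A := by
    intro t
    have : A * (heisenbergEvolution H t B - B) + (heisenbergEvolution H t B - B) * A =
        A * heisenbergEvolution H t B + heisenbergEvolution H t B * A - (A * B + B * A) := by
      noncomm_ring
    rw [this, hAB, sub_zero]
  have hKlip : ∀ t, ‖K t‖ ≤ 2 * Q * |t| := by
    intro t
    refine (hKle t).trans ?_
    rw [hanti t]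
    have hsub : ‖heisenbergEvolution H t B - B‖ ≤ Q * |t| := by
      have h := norm_heisenbergEvolution_sub_le hH B 0 t
      rw [heisenbergEvolution_zero, sub_zero] at h
      exact h.trans (mul_le_mul_of_nonneg_right hcomm (abs_nonneg t))
    calc ‖A * (heisenbergEvolution H t B - B) + (heisenbergEvolution H t B - B) * A‖
        ≤ ‖A * (heisenbergEvolution H t B - B)‖ + ‖(heisenbergEvolution H t B - B) * A‖ :=
          norm_add_le _ _
      _ ≤ ‖A‖ * ‖heisenbergEvolution H t B - B‖ + ‖heisenbergEvolution H t B - B‖ * ‖A‖ :=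
          add_le_add (norm_mul_le _ _) (norm_mul_le _ _)
      _ ≤ 1 * (Q * |t|) + (Q * |t|) * 1 := by
          gcongr
      _ = 2 * Q * |t| := by ring
  have hL1 : ∀ t : ℝ, 0 < t → ‖hfun t - hfun (-t)‖ ≤ 4 * 1 * (2 * 1 * (1 * (Q / 2))) * t := by
    intro t ht
    calc ‖hfun t - hfun (-t)‖ ≤ ‖hfun t‖ + ‖hfun (-t)‖ := norm_sub_le _ _
      _ = ‖K t‖ + ‖K (-t)‖ := by rw [hnormh, hnormh]
      _ ≤ 2 * Q * |t| + 2 * Q * |(-t)| := add_le_add (hKlip t) (hKlip (-t))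
      _ = 4 * 1 * (2 * 1 * (1 * (Q / 2))) * t := by rw [abs_neg, abs_of_pos ht]; ring
  have hL2 : ∀ t : ℝ, ‖hfun t‖ ≤
      C * 1 * 1 * 1 * Real.exp (-μ * D) * Real.exp (μ * v * |t|) := by
    intro t
    rw [hnormh]
    refine ((hKle t).trans (hLR t)).trans (le_of_eq ?_)
    rw [show -μ * (D - v * |t|) = -μ * D + μ * v * |t| by ring, Real.exp_add]
    ring
  have hL3 : ∀ t : ℝ, ‖hfun t‖ ≤ 2 * 1 * 1 := by
    intro t
    rw [hnormh]
    refine (hKle t).trans ?_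
    calc ‖A * heisenbergEvolution H t B + heisenbergEvolution H t B * A‖
        ≤ ‖A * heisenbergEvolution H t B‖ + ‖heisenbergEvolution H t B * A‖ := norm_add_le _ _
      _ ≤ ‖A‖ * ‖heisenbergEvolution H t B‖ + ‖heisenbergEvolution H t B‖ * ‖A‖ :=
          add_le_add (norm_mul_le _ _) (norm_mul_le _ _)
      _ = 2 * ‖A‖ * ‖B‖ := by rw [norm_heisenbergEvolution_holds hH t B]; ring
      _ ≤ 2 * 1 * 1 := by gcongr
  -- parameters and the abstract bound
  have hα' : 0 < γ * v / D := div_pos (mul_pos hγ hv) hD0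
  have ht₁ : 0 < Real.exp (-(μ * D / 4)) := Real.exp_pos _
  have hT : Real.exp (-(μ * D / 4)) ≤ D / (2 * v) := exp_le_div_of_le hμ hv hD0 hD2v
  have key := abstract_clustering_bound none Δ a b hfun hγ hα' ht₁ hT (mul_pos hμ hv).le hΔn hΔγ
    hab hKa hKb hh hL1 hL2 hL3
  -- identify the left-hand side and `h(0) = 0`
  have h0 : hfun 0 = 0 := by
    rw [hhfun, hK, heisenbergEvolution_zero, hAB, zero_mulVec, dotProduct_zero, mul_zero]
  have hsum : ∑ o ∈ univ.erase none, a o = star ψ ⬝ᵥ ((A * B) *ᵥ ψ) := by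
    rw [Finset.sum_erase_eq_sub (Finset.mem_univ _), han, sub_zero, Fintype.sum_option, han,
      zero_add, Fintype.sum_sum_type]
    simp only [hal, har, Finset.sum_const_zero, add_zero]
    simp only [hα]
    rw [sum_dotProduct_mulVec_mul_dotProduct hH A ψ (B *ᵥ ψ), ← mulVec_mulVec]
  rw [hsum, h0, norm_zero] at key
  have hfin := clustering_arith (S := ‖star ψ ⬝ᵥ ((A * B) *ᵥ ψ)‖) (N := Q / 2) hC hμ hv hγ
    (by positivity) hD1 hD2v zero_le_one zero_le_one le_rfl zero_le_one le_rfl key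
  refine hfin.trans (le_of_eq ?_)
  ring

end Summit.HubbardSuperconductivity.HubbardSuperconductivity.Theorems

end
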